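import Summits.QuantumFields.YangMills.Theorems.UnitScaleTiltProp7CornerCombCovMassStep
import HarnessLib

/-!
# Route `UnitScaleTilt`, crux K1 «MinimiserStabilityRegPr» (stmt-QuantumFields-19200), route-R E′ (A′)-on-Σ, P-A2 (β), row «(n3)-comb» —
# (O2) GROUNDWORK, file F-7b-1′: THE PER-LEVEL `ℓ²` MASS ROW OF THE SOURCED COMB TOWER ON ABSORBING SETS (LOCALISED MINKOWSKI) —
# `√Σ_{z∈Zc,κ}‖G̃′‖² ≤ (√(L²L⁻ᵈ) + 210(2d+2)L·α·√(2d))·√Σ_{w∈Zf,ν}‖G̃‖² + C·μ·(2d+2)L·√(2d)·√Σ_{w∈Zf,ν}‖Ỹ‖²` whenever `Zf ⊇` the two blocks and the segments of every `z ∈ Zc`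

«(O2) groundwork — not consumed by any displayed row before the freeze lifts» (★★OWNER `ym3-torus-plan` g29∕g30 RULINGS №20 (2), №22 (c) «(II) GO»).
Cell `ym3-torus`, D-0154 (3c) R3 twin-width seat `ym-routeR-w4` (gen 16); pen F-7b (★routeR-w1 g9 PENS ROUND 4); the ABSORBING-SET form answers px18 g4's interface ask
(2026-08-29 08:58Z) for the H2-1 ∕ `hMcomb₂` member, which prices the sources on the boxes below the level-l corners only.
THEOREMS ONLY (0 `def`, 0 `sorry`); `--supports stmt-QuantumFields-19200 --as helper`, count-neutral.  YM₃ on T³ is a ladder rung (R3), not the Clay problem; nothing here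
claims `hMcomb`, `hMcomb₂`, (β), `hPA2`, `hcoS`, the stub, the crux, d = 4 or the mass gap.

THE POINT.  ✓`Prop7CornerCombCovMassStep.sqrt_sum_cell_normSq_step_le` (F-7b-1) is the mass row over ONE PERIOD CELL (exact incidence counts by periodicity).  Here the same three
pieces are bounded over an ARBITRARY finite set `Zc` of coarse sites against any finite set `Zf` of fine sites absorbing the stencils — the shape of ✓`Prop7CornerCombFlatJensen.
straight_step_sum_normSq_le` (II-2, sockets `hZf`), with the same constants: (i) `Σ_{z∈Zc}‖L·(Q₀X)(L•z,κ)‖² ≤ L²L⁻ᵈ·Σ_{w∈Zf}‖X(w,κ)‖²` if `Zf ∋ L•z + r + t•e_κ` (`t < L`) —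
pointwise covariant Jensen (F-7b-1 ✓`normSq_smul_Q0cov_le`) + the fibre count ✓`card_fiber_le` (II-2); (ii)+(iii) the defect (✓F-5b pointwise) and the source (two-block window
`μ`) against `2d·Σ_{w∈Zf}` if `Zf ⊇` both blocks `L•z + [0,L)ᵈ`, `L•z + Le_κ + [0,L)ᵈ` — each block map is injective (lit ✓`blockMap_injective`), so each family of blocks is
absorbed once (§1 ★`sum_twoBlock_le_of_subset`); Minkowski (F-7b-1 ✓`sqrt_sum_normSq_le_of_le_add₃`).  No periodicity is used: the period-cell row is NOT a corollary (there the
stencils wrap around), the two files are siblings.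
HONEST SCOPE.  As F-7b-1; `𝔸` any non-trivial C⋆-algebra, `V` unitary-valued, every `d`, `L ≥ 1`.

References: T. Bałaban, CMP **98** (1985) 17–51 [Balaban1985Averaging] ((2) p.17, (42)–(43) pp.23–24, Prop. 3 (122)–(126) p.36); CMP **95** (1984) 17–40 [Balaban1984PropagatorsI]
((1.18)–(1.20) pp.19–20); CMP **109** (1987) 249–301 [Balaban1987RG1] ((0.4) p.253).
-/

noncomputable section

open scoped BigOperators
open Finset

namespace Summit.QuantumFields.YangMills.Theorems.Prop7CornerCombCovMassStepLocalised

open NormedSpace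
open Literature.MathematicalPhysics.QuantumFieldTheory.Balaban1983to89
open ExpMeanLog (eml)
open B7Prop1Explicit (Site Letter e hol seg treeWord boxVec gammaWord Wcx Xavg bavg expUnit U1)
open B7Prop2Explicit (unitaryUnits unitaryUnits_le_U1)
open B7Eq78Linearization (conjR)
open B7Prop3GeneralRotated (tsum)
open B7Prop3GeneralLinear (FhatCov Q0cov)
open T4AveragingDeficitWallBoundary (blockMap_injective)
open Summit.QuantumFields.YangMills.Theorems.Prop7CombTrueStepDefectTwoBlock (norm_trueStep_defect_le_twoBlock)
open Summit.QuantumFields.YangMills.Theorems.Prop7CornerCombFlatJensen (card_fiber_le)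
open Summit.QuantumFields.YangMills.Theorems.Prop7CornerCombCovMassStep (normSq_smul_Q0cov_le sqrt_sum_normSq_le_of_le_add₃)

/-! ## §1 Absorption: block families and shifted blocks against a fine set `Zf` -/

section Absorb

variable {d : ℕ}

/-- Regrouping a sum over a finite index set by the image of a map with bounded fibres. [folklore] -/
private theorem sum_comp_le_mul {β : Type*} (P : Finset β) (π : β → Site d) (g : Site d → ℝ) (Zf : Finset (Site d))
    (hmaps : ∀ p ∈ P, π p ∈ Zf) (hg : ∀ w ∈ Zf, 0 ≤ g w) (m : ℕ) (hmult : ∀ w ∈ Zf, #{p ∈ P | π p = w} ≤ m) :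
    ∑ p ∈ P, g (π p) ≤ m * ∑ w ∈ Zf, g w := by
  classical
  rw [Finset.sum_comp (s := P) (f := g) (g := π)]
  have hsub : P.image π ⊆ Zf := by
    intro w hw
    obtain ⟨p, hp, rfl⟩ := Finset.mem_image.mp hw
    exact hmaps p hp
  calc ∑ w ∈ P.image π, (#{p ∈ P | π p = w}) • g w ≤ ∑ w ∈ P.image π, (m : ℝ) * g w := by
        refine Finset.sum_le_sum fun w hw => ?_
        rw [nsmul_eq_mul]
        exact mul_le_mul_of_nonneg_right (by exact_mod_cast hmult w (hsub hw)) (hg w (hsub hw))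
    _ ≤ ∑ w ∈ Zf, (m : ℝ) * g w :=
        Finset.sum_le_sum_of_subset_of_nonneg hsub fun w hw _ => mul_nonneg (Nat.cast_nonneg _) (hg w hw)
    _ = m * ∑ w ∈ Zf, g w := by rw [Finset.mul_sum]

/-- **ONE FAMILY OF BLOCKS IS ABSORBED ONCE**: the blocks `L•(z+v) + [0,L)ᵈ`, `z ∈ Zc`, are pairwise disjoint (lit ✓`blockMap_injective`), so for `F ≥ 0` and `Zf ⊇` all of them
`Σ_{z∈Zc} Σ_{s} F(L•z + L•v + s) ≤ Σ_{w∈Zf} F(w)`. [cite: Balaban1985Averaging, (2) p.17] -/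
theorem sum_blocks_le_of_subset (L : ℕ) (hL : 1 ≤ L) (F : Site d → ℝ) (v : Site d) (Zc Zf : Finset (Site d)) (hF : ∀ w ∈ Zf, 0 ≤ F w)
    (hZf : ∀ z ∈ Zc, ∀ s : Fin d → Fin L, (L : ℤ) • z + (L : ℤ) • v + boxVec L s ∈ Zf) :
    ∑ z ∈ Zc, ∑ s : Fin d → Fin L, F ((L : ℤ) • z + (L : ℤ) • v + boxVec L s) ≤ ∑ w ∈ Zf, F w := by
  classical
  have h := sum_comp_le_mul (Zc ×ˢ (Finset.univ : Finset (Fin d → Fin L))) (fun p => (L : ℤ) • p.1 + (L : ℤ) • v + boxVec L p.2) F Zf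
    (fun p hp => hZf p.1 (Finset.mem_product.mp hp).1 p.2) hF 1 (fun w _ => ?_)
  · rw [Finset.sum_product, Nat.cast_one, one_mul] at h
    exact h
  · refine Finset.card_le_one.mpr fun p hp p' hp' => ?_
    simp only [Finset.mem_filter] at hp hp'
    have heq : (L : ℤ) • (p.1 + v) + boxVec L p.2 = (L : ℤ) • (p'.1 + v) + boxVec L p'.2 := by
      rw [smul_add, smul_add, hp.2, hp'.2]
    have := blockMap_injective L hL (a₁ := (p.1 + v, p.2)) (a₂ := (p'.1 + v, p'.2)) heq
    simp only [Prod.mk.injEq, add_left_inj] at this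
    exact Prod.ext this.1 this.2

/-- ★ **THE TWO BLOCKS OF EVERY COARSE BOND ARE ABSORBED `2d` TIMES**: for `F ≥ 0` on `Zf ⊇` the lower and upper blocks of the bonds `(L•z, κ)`, `z ∈ Zc`, `κ` any direction,
`Σ_{z∈Zc} Σ_κ Σ_s (F(L•z + s) + F(L•z + Le_κ + s)) ≤ 2d·Σ_{w∈Zf} F(w)`. [cite: Balaban1985Averaging, (2) p.17, (42) p.23] -/
theorem sum_twoBlock_le_of_subset (L : ℕ) (hL : 1 ≤ L) (F : Site d → ℝ) (Zc Zf : Finset (Site d)) (hF : ∀ w ∈ Zf, 0 ≤ F w)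
    (hZf : ∀ z ∈ Zc, ∀ (κ : Fin d) (s : Fin d → Fin L), (L : ℤ) • z + boxVec L s ∈ Zf ∧ (L : ℤ) • z + (L : ℤ) • e κ + boxVec L s ∈ Zf) :
    ∑ z ∈ Zc, ∑ κ : Fin d, ∑ s : Fin d → Fin L, (F ((L : ℤ) • z + boxVec L s) + F ((L : ℤ) • z + (L : ℤ) • e κ + boxVec L s))
      ≤ 2 * d * ∑ w ∈ Zf, F w := by
  have hlow : ∀ κ : Fin d, ∑ z ∈ Zc, ∑ s : Fin d → Fin L, F ((L : ℤ) • z + boxVec L s) ≤ ∑ w ∈ Zf, F w := fun κ => by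
    have h := sum_blocks_le_of_subset L hL F 0 Zc Zf hF (fun z hz s => by simpa using (hZf z hz κ s).1)
    simpa using h
  have hup : ∀ κ : Fin d, ∑ z ∈ Zc, ∑ s : Fin d → Fin L, F ((L : ℤ) • z + (L : ℤ) • e κ + boxVec L s) ≤ ∑ w ∈ Zf, F w := fun κ =>
    sum_blocks_le_of_subset L hL F (e κ) Zc Zf hF (fun z hz s => (hZf z hz κ s).2)
  calc ∑ z ∈ Zc, ∑ κ : Fin d, ∑ s : Fin d → Fin L, (F ((L : ℤ) • z + boxVec L s) + F ((L : ℤ) • z + (L : ℤ) • e κ + boxVec L s))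
      = ∑ κ : Fin d, (∑ z ∈ Zc, ∑ s : Fin d → Fin L, F ((L : ℤ) • z + boxVec L s) + ∑ z ∈ Zc, ∑ s : Fin d → Fin L, F ((L : ℤ) • z + (L : ℤ) • e κ + boxVec L s)) := by
        rw [Finset.sum_comm]
        refine Finset.sum_congr rfl fun κ _ => ?_
        rw [← Finset.sum_add_distrib]
        refine Finset.sum_congr rfl fun z _ => ?_
        rw [← Finset.sum_add_distrib]
    _ ≤ ∑ κ : Fin d, (∑ w ∈ Zf, F w + ∑ w ∈ Zf, F w) := Finset.sum_le_sum fun κ _ => add_le_add (hlow κ) (hup κ)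
    _ = 2 * d * ∑ w ∈ Zf, F w := by rw [Finset.sum_const, Finset.card_univ, Fintype.card_fin, nsmul_eq_mul]; ring

end Absorb

section Pieces

variable {d : ℕ} {𝔸 : Type*} [CStarAlgebra 𝔸] [Nontrivial 𝔸]

/-! ## §2 (i) The straight step on absorbing sets -/

/-- ★★ **THE COVARIANT JENSEN ON ABSORBING SETS**: `Zc` any finite set of coarse sites, `Zf ∋ L•z + r + t•e_κ` for all `z ∈ Zc`, `r ∈ [0,L)ᵈ`, `t < L`.  Then
`Σ_{z∈Zc} ‖L·(Q₀X)(L•z,κ)‖² ≤ L²L⁻ᵈ·Σ_{w∈Zf} ‖X(w,κ)‖²` — F-7b-1's pointwise Jensen + II-2's fibre count ✓`card_fiber_le` (each fine bond is met at most `L` times).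
[cite: Balaban1985Averaging, (125) p.36] [cite: Balaban1984PropagatorsI, (1.18)-(1.20) pp.19-20] -/
theorem sum_normSq_smul_Q0cov_le_of_subset (L : ℕ) (hL : 1 ≤ L) (V : Site d → Fin d → 𝔸ˣ) (hV : ∀ x μ, V x μ ∈ unitaryUnits 𝔸)
    (X : Site d → Fin d → 𝔸) (κ : Fin d) (Zc Zf : Finset (Site d))
    (hZf : ∀ z ∈ Zc, ∀ (r : Fin d → Fin L) (t : ℕ), t < L → (L : ℤ) • z + boxVec L r + (t : ℤ) • e κ ∈ Zf) :
    ∑ z ∈ Zc, ‖(L : ℝ) • Q0cov L V X ((L : ℤ) • z) κ‖ ^ 2 ≤ (L : ℝ) ^ 2 * ((L : ℝ) ^ d)⁻¹ * ∑ w ∈ Zf, ‖X w κ‖ ^ 2 := by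
  classical
  set c : ℝ := ((L : ℝ) ^ d)⁻¹ with hc
  set I' : Finset ((Fin d → Fin L) × ℕ) := (Finset.univ : Finset (Fin d → Fin L)) ×ˢ Finset.range L with hI'
  set π : Site d × ((Fin d → Fin L) × ℕ) → Site d := fun p => (L : ℤ) • p.1 + boxVec L p.2.1 + (p.2.2 : ℤ) • e κ with hπ
  calc ∑ z ∈ Zc, ‖(L : ℝ) • Q0cov L V X ((L : ℤ) • z) κ‖ ^ 2
      ≤ ∑ z ∈ Zc, (L : ℝ) * c * ∑ r : Fin d → Fin L, ∑ t ∈ Finset.range L, ‖X ((L : ℤ) • z + boxVec L r + (t : ℤ) • e κ) κ‖ ^ 2 :=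
        Finset.sum_le_sum fun z _ => normSq_smul_Q0cov_le L hL V hV X _ κ
    _ = (L : ℝ) * c * ∑ p ∈ Zc ×ˢ I', ‖X (π p) κ‖ ^ 2 := by
        rw [← Finset.mul_sum, Finset.sum_product]
        simp only [hI', hπ, Finset.sum_product]
    _ ≤ (L : ℝ) * c * ((L : ℕ) * ∑ w ∈ Zf, ‖X w κ‖ ^ 2) := by
        refine mul_le_mul_of_nonneg_left ?_ (by positivity)
        refine sum_comp_le_mul (Zc ×ˢ I') π (fun w => ‖X w κ‖ ^ 2) Zf (fun p hp => ?_) (fun w _ => sq_nonneg _) L (fun w _ => ?_)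
        · rw [Finset.mem_product, hI', Finset.mem_product] at hp
          exact hZf p.1 hp.1 p.2.1 p.2.2 (Finset.mem_range.mp hp.2.2)
        · refine card_fiber_le L hL κ (Zc ×ˢ I') (fun p hp => ?_) w
          rw [Finset.mem_product, hI', Finset.mem_product] at hp
          exact Finset.mem_range.mp hp.2.2
    _ = (L : ℝ) ^ 2 * c * ∑ w ∈ Zf, ‖X w κ‖ ^ 2 := by ring

/-! ## §3 (ii) The defect on absorbing sets -/

/-- ★★ **THE ONE-STEP DEFECT ON ABSORBING SETS**: block loops within `α ≤ 1∕24` of `1` at every corner `L•z`, `z ∈ Zc`; `Zf ⊇` both blocks of every bond `(L•z, κ)`.  Then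
`Σ_{z∈Zc,κ} ‖DEF(L•z,κ)‖² ≤ (210(2d+2)L)²·α²·2d·Σ_{w∈Zf,ν}‖X(w,ν)‖²` — ✓F-5b squared, §1. [cite: Balaban1985Averaging, (42)-(43) pp.23-24, (124)-(126) p.36] -/
theorem sum_normSq_trueStep_defect_le_of_subset (L : ℕ) (hL : 1 ≤ L) (V : Site d → Fin d → 𝔸ˣ) (hV : ∀ x μ, V x μ ∈ unitaryUnits 𝔸)
    (X : Site d → Fin d → 𝔸) (Zc Zf : Finset (Site d)) {α : ℝ}
    (hα : ∀ z ∈ Zc, ∀ (κ : Fin d) (r : Fin d → Fin L), ‖((Wcx L V ((L : ℤ) • z) κ (boxVec L r) : 𝔸ˣ) : 𝔸) - 1‖ ≤ α) (hα24 : α ≤ 1 / 24)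
    (hZf : ∀ z ∈ Zc, ∀ (κ : Fin d) (s : Fin d → Fin L), (L : ℤ) • z + boxVec L s ∈ Zf ∧ (L : ℤ) • z + (L : ℤ) • e κ + boxVec L s ∈ Zf) :
    ∑ z ∈ Zc, ∑ κ : Fin d,
      ‖fderiv ℂ (eml : ((Fin d → Fin L) → 𝔸) → 𝔸) (fun r => ((Wcx L V ((L : ℤ) • z) κ (boxVec L r) : 𝔸ˣ) : 𝔸))
            (fun r => tsum V X ((L : ℤ) • z) (gammaWord L κ (boxVec L r) ++ seg κ (-(L : ℤ))) * ((Wcx L V ((L : ℤ) • z) κ (boxVec L r) : 𝔸ˣ) : 𝔸))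
            * (((expUnit (Xavg L V ((L : ℤ) • z) κ))⁻¹ : 𝔸ˣ) : 𝔸)
          + ((expUnit (Xavg L V ((L : ℤ) • z) κ) : 𝔸ˣ) : 𝔸) * tsum V X ((L : ℤ) • z) (seg κ (L : ℤ))
            * (((expUnit (Xavg L V ((L : ℤ) • z) κ))⁻¹ : 𝔸ˣ) : 𝔸)
          - (FhatCov L V X ((L : ℤ) • z) - conjR (bavg L V ((L : ℤ) • z) κ) (FhatCov L V X ((L : ℤ) • z + (L : ℤ) • e κ))
              + (L : ℝ) • Q0cov L V X ((L : ℤ) • z) κ)‖ ^ 2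
      ≤ (210 * ((2 * d + 2) * L)) ^ 2 * α ^ 2 * (2 * d) * ∑ w ∈ Zf, ∑ ν : Fin d, ‖X w ν‖ ^ 2 := by
  set F : Site d → ℝ := fun y => ∑ ν : Fin d, ‖X y ν‖ ^ 2 with hF
  set C : ℝ := (210 * ((2 * d + 2) * L)) ^ 2 * α ^ 2 with hC
  have hC0 : 0 ≤ C := by positivity
  have hpt : ∀ z ∈ Zc, ∀ κ : Fin d,
      ‖fderiv ℂ (eml : ((Fin d → Fin L) → 𝔸) → 𝔸) (fun r => ((Wcx L V ((L : ℤ) • z) κ (boxVec L r) : 𝔸ˣ) : 𝔸))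
            (fun r => tsum V X ((L : ℤ) • z) (gammaWord L κ (boxVec L r) ++ seg κ (-(L : ℤ))) * ((Wcx L V ((L : ℤ) • z) κ (boxVec L r) : 𝔸ˣ) : 𝔸))
            * (((expUnit (Xavg L V ((L : ℤ) • z) κ))⁻¹ : 𝔸ˣ) : 𝔸)
          + ((expUnit (Xavg L V ((L : ℤ) • z) κ) : 𝔸ˣ) : 𝔸) * tsum V X ((L : ℤ) • z) (seg κ (L : ℤ))
            * (((expUnit (Xavg L V ((L : ℤ) • z) κ))⁻¹ : 𝔸ˣ) : 𝔸)
          - (FhatCov L V X ((L : ℤ) • z) - conjR (bavg L V ((L : ℤ) • z) κ) (FhatCov L V X ((L : ℤ) • z + (L : ℤ) • e κ))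
              + (L : ℝ) • Q0cov L V X ((L : ℤ) • z) κ)‖ ^ 2
        ≤ C * ∑ s : Fin d → Fin L, (F ((L : ℤ) • z + boxVec L s) + F ((L : ℤ) • z + (L : ℤ) • e κ + boxVec L s)) := by
    intro z hz κ
    have h := norm_trueStep_defect_le_twoBlock L hL V hV X ((L : ℤ) • z) κ (hα z hz κ) hα24
    refine (pow_le_pow_left₀ (norm_nonneg _) h 2).trans_eq ?_
    rw [mul_pow, mul_pow, mul_pow, Real.sq_sqrt (by positivity), hC]
    simp only [hF, Finset.sum_add_distrib]
    ring
  calc _ ≤ ∑ z ∈ Zc, ∑ κ : Fin d, C * ∑ s : Fin d → Fin L, (F ((L : ℤ) • z + boxVec L s) + F ((L : ℤ) • z + (L : ℤ) • e κ + boxVec L s)) :=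
        Finset.sum_le_sum fun z hz => Finset.sum_le_sum fun κ _ => hpt z hz κ
    _ = C * ∑ z ∈ Zc, ∑ κ : Fin d, ∑ s : Fin d → Fin L, (F ((L : ℤ) • z + boxVec L s) + F ((L : ℤ) • z + (L : ℤ) • e κ + boxVec L s)) := by
        simp only [Finset.mul_sum]
    _ ≤ C * (2 * d * ∑ w ∈ Zf, F w) :=
        mul_le_mul_of_nonneg_left (sum_twoBlock_le_of_subset L hL F Zc Zf (fun w _ => by positivity) hZf) hC0
    _ = _ := by rw [hC]; ring

/-! ## §4 (iii) The source on absorbing sets -/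

/-- ★★ **THE SOURCE ON ABSORBING SETS**: `‖rem(z,κ)‖ ≤ C·((2d+2)L)²·M₂[Y](L•z,κ)` and the window `(2d+2)L·√M₂[Y](L•z,κ) ≤ μ` for `z ∈ Zc`; `Zf ⊇` both blocks of every bond.  Then
`Σ_{z∈Zc,κ}‖rem(z,κ)‖² ≤ (Cμ)²·((2d+2)L)²·2d·Σ_{w∈Zf,ν}‖Y(w,ν)‖²`. [cite: Balaban1985Averaging, (42) p.23, Prop. 3 (122)-(126) p.36; Balaban1987RG1, (0.4) p.253] -/
theorem sum_normSq_source_le_of_subset {E : Type*} [SeminormedAddCommGroup E] (L : ℕ) (hL : 1 ≤ L) (R Y : Site d → Fin d → E)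
    (Zc Zf : Finset (Site d)) {C μ : ℝ} (hC : 0 ≤ C)
    (hR : ∀ z ∈ Zc, ∀ κ : Fin d, ‖R z κ‖ ≤ C * (((2 * d + 2) * L) ^ 2 * ∑ s : Fin d → Fin L, ∑ ν : Fin d,
      (‖Y ((L : ℤ) • z + boxVec L s) ν‖ ^ 2 + ‖Y ((L : ℤ) • z + (L : ℤ) • e κ + boxVec L s) ν‖ ^ 2)))
    (hμ : ∀ z ∈ Zc, ∀ κ : Fin d, (2 * d + 2) * L * Real.sqrt (∑ s : Fin d → Fin L, ∑ ν : Fin d,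
      (‖Y ((L : ℤ) • z + boxVec L s) ν‖ ^ 2 + ‖Y ((L : ℤ) • z + (L : ℤ) • e κ + boxVec L s) ν‖ ^ 2)) ≤ μ)
    (hZf : ∀ z ∈ Zc, ∀ (κ : Fin d) (s : Fin d → Fin L), (L : ℤ) • z + boxVec L s ∈ Zf ∧ (L : ℤ) • z + (L : ℤ) • e κ + boxVec L s ∈ Zf) :
    ∑ z ∈ Zc, ∑ κ : Fin d, ‖R z κ‖ ^ 2 ≤ (C * μ) ^ 2 * (((2 * d + 2) * L) ^ 2 * (2 * d * ∑ w ∈ Zf, ∑ ν : Fin d, ‖Y w ν‖ ^ 2)) := by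
  set F : Site d → ℝ := fun y => ∑ ν : Fin d, ‖Y y ν‖ ^ 2 with hF
  set M₂ : Site d → Fin d → ℝ := fun z κ => ∑ s : Fin d → Fin L, ∑ ν : Fin d,
    (‖Y ((L : ℤ) • z + boxVec L s) ν‖ ^ 2 + ‖Y ((L : ℤ) • z + (L : ℤ) • e κ + boxVec L s) ν‖ ^ 2) with hM₂
  have hM0 : ∀ z κ, 0 ≤ M₂ z κ := fun z κ => by positivity
  have hpt : ∀ z ∈ Zc, ∀ κ : Fin d, ‖R z κ‖ ^ 2 ≤ (C * μ) ^ 2 * (((2 * d + 2) * L) ^ 2 * M₂ z κ) := by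
    intro z hz κ
    set x : ℝ := (2 * d + 2) * L * Real.sqrt (M₂ z κ) with hx
    have hx0 : 0 ≤ x := by positivity
    have hx2 : x ^ 2 = ((2 * d + 2) * L) ^ 2 * M₂ z κ := by rw [hx, mul_pow, Real.sq_sqrt (hM0 z κ)]
    have h1 : ‖R z κ‖ ≤ C * μ * x := by
      calc ‖R z κ‖ ≤ C * x ^ 2 := by rw [hx2]; exact hR z hz κ
        _ = C * x * x := by ring
        _ ≤ C * μ * x := mul_le_mul_of_nonneg_right (mul_le_mul_of_nonneg_left (hμ z hz κ) hC) hx0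
    calc ‖R z κ‖ ^ 2 ≤ (C * μ * x) ^ 2 := pow_le_pow_left₀ (norm_nonneg _) h1 2
      _ = (C * μ) ^ 2 * (((2 * d + 2) * L) ^ 2 * M₂ z κ) := by rw [← hx2]; ring
  have hM₂F : ∀ z κ, M₂ z κ = ∑ s : Fin d → Fin L, (F ((L : ℤ) • z + boxVec L s) + F ((L : ℤ) • z + (L : ℤ) • e κ + boxVec L s)) := fun z κ => by
    simp only [hM₂, hF, Finset.sum_add_distrib]
  calc ∑ z ∈ Zc, ∑ κ : Fin d, ‖R z κ‖ ^ 2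
      ≤ ∑ z ∈ Zc, ∑ κ : Fin d, (C * μ) ^ 2 * (((2 * d + 2) * L) ^ 2 * M₂ z κ) :=
        Finset.sum_le_sum fun z hz => Finset.sum_le_sum fun κ _ => hpt z hz κ
    _ = (C * μ) ^ 2 * (((2 * d + 2) * L) ^ 2 * ∑ z ∈ Zc, ∑ κ : Fin d, ∑ s : Fin d → Fin L,
          (F ((L : ℤ) • z + boxVec L s) + F ((L : ℤ) • z + (L : ℤ) • e κ + boxVec L s))) := by
        simp only [Finset.mul_sum, hM₂F]
    _ ≤ (C * μ) ^ 2 * (((2 * d + 2) * L) ^ 2 * (2 * d * ∑ w ∈ Zf, F w)) := by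
        gcongr
        exact sum_twoBlock_le_of_subset L hL F Zc Zf (fun w _ => by positivity) hZf
    _ = _ := by rw [hF]

end Pieces

/-! ## §5 ★★★ The localised mass row -/

section Row

variable {d : ℕ} {𝔸 : Type*} [CStarAlgebra 𝔸] [Nontrivial 𝔸]

/-- ★★★ **THE PER-LEVEL `ℓ²` MASS ROW OF THE SOURCED COMB TOWER ON ABSORBING SETS.**  As ✓`Prop7CornerCombCovMassStep.sqrt_sum_cell_normSq_step_le` (F-7b-1) with the period
cell replaced by ANY finite set `Zc` of coarse sites and the fine cell by ANY finite `Zf ⊇ {L•z + r + t•e_κ : t < L} ∪ (L•z + [0,L)ᵈ) ∪ (L•z + Le_κ + [0,L)ᵈ)` (`z ∈ Zc`, all `κ`, `r`):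
block loops `≤ α ≤ 1∕24` at the corners `L•z`, `z ∈ Zc`; source `‖rem(z,κ)‖ ≤ C((2d+2)L)²M₂[Y](L•z,κ)` with window `(2d+2)L√M₂ ≤ μ` on `Zc`; `X′` the sourced one-step image on `Zc`.
Then `√Σ_{z∈Zc,κ}‖X′(z,κ)‖² ≤ (√(L²L⁻ᵈ) + 210(2d+2)L·α·√(2d))·√Σ_{w∈Zf,ν}‖X(w,ν)‖² + C·μ·(2d+2)L·√(2d)·√Σ_{w∈Zf,ν}‖Y(w,ν)‖²` — no periodicity; for the H2-1 member's
localised chains (px18). «(O2) groundwork.» [cite: Balaban1985Averaging, (2) p.17, (42)-(43) pp.23-24, Prop. 3 (122)-(126) p.36] [cite: Balaban1984PropagatorsI, (1.18)-(1.20) pp.19-20] -/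
theorem sqrt_sum_normSq_step_le_of_subset (L : ℕ) (hL : 1 ≤ L) (V : Site d → Fin d → 𝔸ˣ) (hV : ∀ x μ, V x μ ∈ unitaryUnits 𝔸)
    (X X' R Y : Site d → Fin d → 𝔸) (Zc Zf : Finset (Site d))
    (hZf : ∀ z ∈ Zc, ∀ (κ : Fin d) (r : Fin d → Fin L) (t : ℕ), t ≤ L → (L : ℤ) • z + boxVec L r + (t : ℤ) • e κ ∈ Zf)
    {α : ℝ} (hα0 : 0 ≤ α) (hα24 : α ≤ 1 / 24)
    (hα : ∀ z ∈ Zc, ∀ (κ : Fin d) (r : Fin d → Fin L), ‖((Wcx L V ((L : ℤ) • z) κ (boxVec L r) : 𝔸ˣ) : 𝔸) - 1‖ ≤ α)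
    {C μ : ℝ} (hC : 0 ≤ C) (hμ0 : 0 ≤ μ)
    (hR : ∀ z ∈ Zc, ∀ κ : Fin d, ‖R z κ‖ ≤ C * (((2 * d + 2) * L) ^ 2 * ∑ s : Fin d → Fin L, ∑ ν : Fin d,
      (‖Y ((L : ℤ) • z + boxVec L s) ν‖ ^ 2 + ‖Y ((L : ℤ) • z + (L : ℤ) • e κ + boxVec L s) ν‖ ^ 2)))
    (hμ : ∀ z ∈ Zc, ∀ κ : Fin d, (2 * d + 2) * L * Real.sqrt (∑ s : Fin d → Fin L, ∑ ν : Fin d,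
      (‖Y ((L : ℤ) • z + boxVec L s) ν‖ ^ 2 + ‖Y ((L : ℤ) • z + (L : ℤ) • e κ + boxVec L s) ν‖ ^ 2)) ≤ μ)
    (hX' : ∀ z ∈ Zc, ∀ κ : Fin d, X' z κ
      = fderiv ℂ (eml : ((Fin d → Fin L) → 𝔸) → 𝔸) (fun r => ((Wcx L V ((L : ℤ) • z) κ (boxVec L r) : 𝔸ˣ) : 𝔸))
            (fun r => tsum V X ((L : ℤ) • z) (gammaWord L κ (boxVec L r) ++ seg κ (-(L : ℤ))) * ((Wcx L V ((L : ℤ) • z) κ (boxVec L r) : 𝔸ˣ) : 𝔸))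
            * (((expUnit (Xavg L V ((L : ℤ) • z) κ))⁻¹ : 𝔸ˣ) : 𝔸)
          + ((expUnit (Xavg L V ((L : ℤ) • z) κ) : 𝔸ˣ) : 𝔸) * tsum V X ((L : ℤ) • z) (seg κ (L : ℤ))
            * (((expUnit (Xavg L V ((L : ℤ) • z) κ))⁻¹ : 𝔸ˣ) : 𝔸)
        - (FhatCov L V X ((L : ℤ) • z) - conjR (bavg L V ((L : ℤ) • z) κ) (FhatCov L V X ((L : ℤ) • z + (L : ℤ) • e κ)))
        + R z κ) :
    Real.sqrt (∑ z ∈ Zc, ∑ κ : Fin d, ‖X' z κ‖ ^ 2)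
      ≤ (Real.sqrt ((L : ℝ) ^ 2 * ((L : ℝ) ^ d)⁻¹) + 210 * ((2 * d + 2) * L) * α * Real.sqrt (2 * d))
          * Real.sqrt (∑ w ∈ Zf, ∑ ν : Fin d, ‖X w ν‖ ^ 2)
        + C * μ * ((2 * d + 2) * L) * Real.sqrt (2 * d) * Real.sqrt (∑ w ∈ Zf, ∑ ν : Fin d, ‖Y w ν‖ ^ 2) := by
  classical
  -- the sockets in the three shapes used below
  have hZseg : ∀ κ : Fin d, ∀ z ∈ Zc, ∀ (r : Fin d → Fin L) (t : ℕ), t < L → (L : ℤ) • z + boxVec L r + (t : ℤ) • e κ ∈ Zf :=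
    fun κ z hz r t ht => hZf z hz κ r t ht.le
  have hZbl : ∀ z ∈ Zc, ∀ (κ : Fin d) (s : Fin d → Fin L), (L : ℤ) • z + boxVec L s ∈ Zf ∧ (L : ℤ) • z + (L : ℤ) • e κ + boxVec L s ∈ Zf := by
    intro z hz κ s
    refine ⟨by simpa using hZf z hz κ s 0 (Nat.zero_le _), ?_⟩
    have h := hZf z hz κ s L le_rfl
    rwa [add_right_comm] at h
  -- letters
  set S : Site d × Fin d → 𝔸 := fun p => (L : ℝ) • Q0cov L V X ((L : ℤ) • p.1) p.2 with hS
  set D : Site d × Fin d → 𝔸 := fun p =>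
    fderiv ℂ (eml : ((Fin d → Fin L) → 𝔸) → 𝔸) (fun r => ((Wcx L V ((L : ℤ) • p.1) p.2 (boxVec L r) : 𝔸ˣ) : 𝔸))
          (fun r => tsum V X ((L : ℤ) • p.1) (gammaWord L p.2 (boxVec L r) ++ seg p.2 (-(L : ℤ))) * ((Wcx L V ((L : ℤ) • p.1) p.2 (boxVec L r) : 𝔸ˣ) : 𝔸))
          * (((expUnit (Xavg L V ((L : ℤ) • p.1) p.2))⁻¹ : 𝔸ˣ) : 𝔸)
        + ((expUnit (Xavg L V ((L : ℤ) • p.1) p.2) : 𝔸ˣ) : 𝔸) * tsum V X ((L : ℤ) • p.1) (seg p.2 (L : ℤ))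
          * (((expUnit (Xavg L V ((L : ℤ) • p.1) p.2))⁻¹ : 𝔸ˣ) : 𝔸)
      - (FhatCov L V X ((L : ℤ) • p.1) - conjR (bavg L V ((L : ℤ) • p.1) p.2) (FhatCov L V X ((L : ℤ) • p.1 + (L : ℤ) • e p.2))
          + (L : ℝ) • Q0cov L V X ((L : ℤ) • p.1) p.2) with hD
  set MX : ℝ := ∑ w ∈ Zf, ∑ ν : Fin d, ‖X w ν‖ ^ 2 with hMX
  set MY : ℝ := ∑ w ∈ Zf, ∑ ν : Fin d, ‖Y w ν‖ ^ 2 with hMY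
  have hpt : ∀ p ∈ Zc ×ˢ (Finset.univ : Finset (Fin d)), ‖X' p.1 p.2‖ ≤ ‖S p‖ + ‖D p‖ + ‖R p.1 p.2‖ := by
    rintro ⟨z, κ⟩ hp
    have hz : z ∈ Zc := (Finset.mem_product.mp hp).1
    have hdec : X' z κ = S (z, κ) + D (z, κ) + R z κ := by simp only [hS, hD]; rw [hX' z hz κ]; abel
    rw [hdec]
    exact norm_add₃_le
  have hMink := sqrt_sum_normSq_le_of_le_add₃ (Zc ×ˢ (Finset.univ : Finset (Fin d))) (fun p => X' p.1 p.2)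
    (fun p => ‖S p‖) (fun p => ‖D p‖) (fun p => ‖R p.1 p.2‖) hpt
  simp only [Finset.sum_product] at hMink
  -- (i)
  have h1 : Real.sqrt (∑ z ∈ Zc, ∑ κ : Fin d, ‖S (z, κ)‖ ^ 2) ≤ Real.sqrt ((L : ℝ) ^ 2 * ((L : ℝ) ^ d)⁻¹) * Real.sqrt MX := by
    rw [← Real.sqrt_mul (by positivity)]
    refine Real.sqrt_le_sqrt ?_
    calc ∑ z ∈ Zc, ∑ κ : Fin d, ‖S (z, κ)‖ ^ 2 = ∑ κ : Fin d, ∑ z ∈ Zc, ‖(L : ℝ) • Q0cov L V X ((L : ℤ) • z) κ‖ ^ 2 := by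
          simp only [hS]; exact Finset.sum_comm
      _ ≤ ∑ κ : Fin d, (L : ℝ) ^ 2 * ((L : ℝ) ^ d)⁻¹ * ∑ w ∈ Zf, ‖X w κ‖ ^ 2 :=
          Finset.sum_le_sum fun κ _ => sum_normSq_smul_Q0cov_le_of_subset L hL V hV X κ Zc Zf (hZseg κ)
      _ = (L : ℝ) ^ 2 * ((L : ℝ) ^ d)⁻¹ * MX := by rw [← Finset.mul_sum, hMX, Finset.sum_comm]
  -- (ii)
  have h2 : Real.sqrt (∑ z ∈ Zc, ∑ κ : Fin d, ‖D (z, κ)‖ ^ 2) ≤ 210 * ((2 * d + 2) * L) * α * Real.sqrt (2 * d) * Real.sqrt MX := by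
    have hD2 := sum_normSq_trueStep_defect_le_of_subset L hL V hV X Zc Zf hα hα24 hZbl
    have e1 : (210 * ((2 * (d : ℝ) + 2) * L)) ^ 2 * α ^ 2 * (2 * d) * MX = (210 * ((2 * d + 2) * L) * α) ^ 2 * ((2 * d) * MX) := by ring
    have hK0 : 0 ≤ 210 * ((2 * (d : ℝ) + 2) * L) * α := by positivity
    calc Real.sqrt (∑ z ∈ Zc, ∑ κ : Fin d, ‖D (z, κ)‖ ^ 2)
        ≤ Real.sqrt ((210 * ((2 * (d : ℝ) + 2) * L)) ^ 2 * α ^ 2 * (2 * d) * MX) := by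
          refine Real.sqrt_le_sqrt ?_
          simp only [hD, hMX]
          exact hD2
      _ = 210 * ((2 * d + 2) * L) * α * Real.sqrt (2 * d) * Real.sqrt MX := by
          rw [e1, Real.sqrt_mul (sq_nonneg _), Real.sqrt_sq hK0, Real.sqrt_mul (by positivity)]
          ring
  -- (iii)
  have h3 : Real.sqrt (∑ z ∈ Zc, ∑ κ : Fin d, ‖R z κ‖ ^ 2) ≤ C * μ * ((2 * d + 2) * L) * Real.sqrt (2 * d) * Real.sqrt MY := by
    have h := sum_normSq_source_le_of_subset L hL R Y Zc Zf hC hR hμ hZbl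
    have hK0 : 0 ≤ C * μ * ((2 * (d : ℝ) + 2) * L) := by positivity
    have e1 : (C * μ) ^ 2 * (((2 * (d : ℝ) + 2) * L) ^ 2 * (2 * d * MY)) = (C * μ * ((2 * d + 2) * L)) ^ 2 * ((2 * d) * MY) := by ring
    calc Real.sqrt (∑ z ∈ Zc, ∑ κ : Fin d, ‖R z κ‖ ^ 2) ≤ Real.sqrt ((C * μ * ((2 * (d : ℝ) + 2) * L)) ^ 2 * ((2 * d) * MY)) := by
          rw [← e1]; exact Real.sqrt_le_sqrt h
      _ = C * μ * ((2 * d + 2) * L) * Real.sqrt (2 * d) * Real.sqrt MY := by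
          rw [Real.sqrt_mul (sq_nonneg _), Real.sqrt_sq hK0, Real.sqrt_mul (by positivity)]
          ring
  calc Real.sqrt (∑ z ∈ Zc, ∑ κ : Fin d, ‖X' z κ‖ ^ 2)
      ≤ Real.sqrt (∑ z ∈ Zc, ∑ κ : Fin d, ‖S (z, κ)‖ ^ 2) + Real.sqrt (∑ z ∈ Zc, ∑ κ : Fin d, ‖D (z, κ)‖ ^ 2)
          + Real.sqrt (∑ z ∈ Zc, ∑ κ : Fin d, ‖R z κ‖ ^ 2) := hMink
    _ ≤ Real.sqrt ((L : ℝ) ^ 2 * ((L : ℝ) ^ d)⁻¹) * Real.sqrt MX + 210 * ((2 * d + 2) * L) * α * Real.sqrt (2 * d) * Real.sqrt MX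
          + C * μ * ((2 * d + 2) * L) * Real.sqrt (2 * d) * Real.sqrt MY := add_le_add (add_le_add h1 h2) h3
    _ = _ := by rw [hMX, hMY]; ring

end Row

end Summit.QuantumFields.YangMills.Theorems.Prop7CornerCombCovMassStepLocalised

end
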